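import Summits.Ventures.PercRepro.Night2ThreeTwoLineCount

/-!
# PercRepro — the non-`P` loss mass of a target through its covering bases (night-2, gen 25)

The fair-share layer of the hybrid rule serves the non-`P` pairs (the basis members, `|B ∖ K| + 1 = ρ`) with the mass
`pi2MassH S = Σ_{(B, z) non-P, S ∈ tgt(B, z)} rhoL B z`.  Exactly as for `pi2Mass` in the unsaturated regime
(`pi2Mass_le_excess_indep`), every such pair is a face `(K ∪ T) ∖ z` of a covering basis `K ∪ T` of `S` with
`rhoL = faceLoss (K ∪ T) z / (2^{n−ρ} − 1)`, the map `(B, z) ↦ (T, z)` is injective, and so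

* **`pi2MassH_le_coverBases`**: `pi2MassH S ≤ #coverBases(S) · E / (2^{n−ρ} − 1)` whenever the face losses of every
  covering basis of `S` sum to at most `E`;
* **`pi2MassH_le_lineCount`** (cell `(3, 2)`): with a rank-`≤ 2` set `ℓ`, `pi2MassH S ≤ lineCount i j · E/(2^{n−4} − 1)`,
  `i = |(S ∖ K) ∩ ℓ|`, `j = |(S ∖ K) ∖ ℓ|` — the quadratic count on the line (proofs/NIGHT-2-g25.md §5″).
-/

namespace PercRepro.Shadow

open Finset PerFlat ThmH

variable {α : Type*} [DecidableEq α] {M : Matroid α} [M.Finite]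

section BasisMass

variable {G : Finset α}

open scoped Classical in
/-- **The non-`P` loss mass of a target through its covering bases.** -/
theorem pi2MassH_le_coverBases {q d ρ : ℕ} (hG : G ∈ flatsQ M (q + 1)) (hd : (gr M \ G).card = d) (hdq : d ≤ q)
    (hk : kColoops M G + ρ = q + 1) {P : Finset α → Prop} [DecidablePred P]
    (hP : ∀ B ∈ thinMembers M q G, ¬ P B → (B \ coloops M G).card + 1 = ρ) {E : ℚ} (S : Finset α)
    (hTE : ∀ T ∈ coverBases M G S ρ, ∑ w ∈ T, faceLoss M q G (coloops M G ∪ T) w ≤ E) :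
    pi2MassH M q G P S ≤
      ((coverBases M G S ρ).card : ℚ) * (E / ((2 ^ ((G.card - kColoops M G) - ρ) - 1 : ℕ) : ℚ)) := by
  have hd' : (gr M \ G).card ≤ q := by omega
  set r := (G.card - kColoops M G) - ρ with hr
  set D : ℚ := ((2 ^ r - 1 : ℕ) : ℚ) with hD
  have hD0 : 0 ≤ D := by rw [hD]; positivity
  -- the mass as a sum over the pairs `(B, z)` with `S` a target
  set F := ((thinMembers M q G).filter (fun B => ¬ P B)).sigma
    (fun B => (G \ clF M B).filter (fun z => S ∈ tgtSets M q G B z)) with hF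
  have hsum : pi2MassH M q G P S = ∑ x ∈ F, rhoL M q G x.1 x.2 := by
    unfold pi2MassH
    rw [hF, Finset.sum_sigma]
    apply Finset.sum_congr rfl
    intro B _
    rw [Finset.sum_filter]
  rw [hsum]
  set g : (Σ _T : Finset α, α) → ℚ := fun x => faceLoss M q G (coloops M G ∪ x.1) x.2 / D with hg
  set φ : (Σ _B : Finset α, α) → (Σ _T : Finset α, α) := fun x => ⟨insert x.2 (x.1 \ coloops M G), x.2⟩ with hφ
  have hmem : ∀ x ∈ F, x.1 ∈ thinMembers M q G ∧ x.2 ∈ G \ clF M x.1 ∧ S ∈ tgtSets M q G x.1 x.2 ∧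
      (x.1 \ coloops M G).card + 1 = ρ := by
    intro x hx
    rw [hF, Finset.mem_sigma, Finset.mem_filter, Finset.mem_filter] at hx
    exact ⟨hx.1.1, hx.2.1, hx.2.2, hP x.1 hx.1.1 hx.1.2⟩
  have hQ : ∀ x ∈ F, coloops M G ∪ insert x.2 (x.1 \ coloops M G) = insert x.2 x.1 := by
    intro x hx
    obtain ⟨hB, -, -, -⟩ := hmem x hx
    have hK : coloops M G ⊆ x.1 := coloops_subset_of_mem_thinMembers hG hd' hB
    ext y
    simp only [Finset.mem_union, Finset.mem_insert, Finset.mem_sdiff]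
    constructor
    · rintro (h | h | ⟨h, -⟩)
      · exact Or.inr (hK h)
      · exact Or.inl h
      · exact Or.inr h
    · rintro (h | h)
      · exact Or.inr (Or.inl h)
      · by_cases hy : y ∈ coloops M G
        · exact Or.inl hy
        · exact Or.inr (Or.inr ⟨h, hy⟩)
  have hval : ∀ x ∈ F, rhoL M q G x.1 x.2 = g (φ x) := by
    intro x hx
    obtain ⟨hB, hz, -, h2⟩ := hmem x hx
    have hB' : x.1 ∈ membersIn M (Uq M (q + 2) q) G := (mem_thinMembers.1 hB).1
    have hBU : x.1 ∈ Uq M (q + 2) q := (mem_membersIn.1 hB').1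
    have hzB : x.2 ∉ x.1 := notMem_of_notMem_clF hBU (Finset.mem_sdiff.1 hz).2
    simp only [hg, hφ]
    rw [hQ x hx]
    unfold rhoL faceLoss
    rw [Finset.erase_insert hzB, if_pos ⟨hB, hz⟩, card_tgtSets hG hB' hz,
      card_sdiff_insert_eq_dqm1 hG hd' hB h2 hz, ← hr]
  have hinj : Set.InjOn φ (F : Set (Σ _B : Finset α, α)) := by
    intro x hx x' hx' heq
    rw [Finset.mem_coe] at hx hx'
    obtain ⟨hB, hz, -, -⟩ := hmem x hx
    obtain ⟨hB', hz', -, -⟩ := hmem x' hx'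
    simp only [hφ, Sigma.mk.injEq] at heq
    obtain ⟨hT, hzz⟩ := heq
    have hzz' : x.2 = x'.2 := eq_of_heq hzz
    have hBU : x.1 ∈ Uq M (q + 2) q := (mem_membersIn.1 (mem_thinMembers.1 hB).1).1
    have hBU' : x'.1 ∈ Uq M (q + 2) q := (mem_membersIn.1 (mem_thinMembers.1 hB').1).1
    have hBB := lossPairs_inj hG hd' hB hB' hT hzz'
      (notMem_of_notMem_clF hBU (Finset.mem_sdiff.1 hz).2)
      (notMem_of_notMem_clF hBU' (Finset.mem_sdiff.1 hz').2)
    exact Sigma.ext hBB (heq_of_eq hzz')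
  have himg : Finset.image φ F ⊆ (coverBases M G S ρ).sigma (fun T => T) := by
    intro y hy
    rw [Finset.mem_image] at hy
    obtain ⟨x, hx, rfl⟩ := hy
    obtain ⟨hB, hz, hxS, h2⟩ := hmem x hx
    have hB' : x.1 ∈ membersIn M (Uq M (q + 2) q) G := (mem_thinMembers.1 hB).1
    have hBU : x.1 ∈ Uq M (q + 2) q := (mem_membersIn.1 hB').1
    have hzB : x.2 ∉ x.1 := notMem_of_notMem_clF hBU (Finset.mem_sdiff.1 hz).2
    have hzK : x.2 ∉ x.1 \ coloops M G := fun hh => hzB (Finset.mem_sdiff.1 hh).1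
    have hsub : insert x.2 x.1 ⊆ S := (mem_tgtSets.1 hxS).2.1
    have hK : coloops M G ⊆ x.1 := coloops_subset_of_mem_thinMembers hG hd' hB
    have hcard : (insert x.2 x.1 \ coloops M G).card = ρ := by
      have : insert x.2 x.1 \ coloops M G = insert x.2 (x.1 \ coloops M G) := by
        ext y
        simp only [Finset.mem_sdiff, Finset.mem_insert]
        constructor
        · rintro ⟨h | h, hy⟩
          · exact Or.inl h
          · exact Or.inr ⟨h, hy⟩
        · rintro (rfl | ⟨h, hy⟩)
          · exact ⟨Or.inl rfl, fun hc => hzB (hK hc)⟩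
          · exact ⟨Or.inr h, hy⟩
      rw [this, Finset.card_insert_of_notMem hzK, h2]
    have hind : M.Indep ((coloops M G ∪ insert x.2 (x.1 \ coloops M G) : Finset α) : Set α) := by
      rw [hQ x hx]
      exact indep_of_mem_shadowAt_card hk (insert_mem_shadowAt_thin hG hB hz) hcard
    simp only [hφ]
    rw [Finset.mem_sigma]
    refine ⟨?_, Finset.mem_insert_self _ _⟩
    unfold coverBases
    rw [Finset.mem_filter, Finset.mem_powersetCard]
    refine ⟨⟨?_, ?_⟩, hind⟩
    · intro y hy
      rw [Finset.mem_insert] at hy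
      rw [Finset.mem_sdiff]
      rcases hy with rfl | hy
      · exact ⟨hsub (Finset.mem_insert_self _ _), fun hzc => hzB (hK hzc)⟩
      · rw [Finset.mem_sdiff] at hy
        exact ⟨hsub (Finset.mem_insert_of_mem hy.1), hy.2⟩
    · rw [Finset.card_insert_of_notMem hzK, h2]
  have hg0 : ∀ y, 0 ≤ g y := fun y => div_nonneg (faceLoss_nonneg hG hd' _ _) hD0
  calc ∑ x ∈ F, rhoL M q G x.1 x.2 = ∑ x ∈ F, g (φ x) := Finset.sum_congr rfl hval
    _ = ∑ y ∈ Finset.image φ F, g y := (Finset.sum_image hinj).symm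
    _ ≤ ∑ y ∈ (coverBases M G S ρ).sigma (fun T => T), g y :=
        Finset.sum_le_sum_of_subset_of_nonneg himg (fun y _ _ => hg0 y)
    _ = ∑ T ∈ coverBases M G S ρ, (∑ w ∈ T, faceLoss M q G (coloops M G ∪ T) w) / D := by
        rw [Finset.sum_sigma]
        apply Finset.sum_congr rfl
        intro T _
        rw [Finset.sum_div]
    _ ≤ ∑ _T ∈ coverBases M G S ρ, E / D := by
        apply Finset.sum_le_sum
        intro T hT
        exact div_le_div_of_nonneg_right (hTE T hT) hD0
    _ = ((coverBases M G S ρ).card : ℚ) * (E / D) := by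
        rw [Finset.sum_const, nsmul_eq_mul]

open scoped Classical in
/-- **The non-`P` mass along a line** (cell `(3, 2)`, `P ⊇` the big members): with `ℓ` of rank `≤ 2` and the face
losses of every covering basis of `S` summing to at most `E`,
`pi2MassH S ≤ lineCount i j · E/(2^{n−4} − 1)`, `i = |(S ∖ K) ∩ ℓ|`, `j = |(S ∖ K) ∖ ℓ|`. -/
theorem pi2MassH_le_lineCount (hG : G ∈ flatsQ M (5 + 1)) (hd : (gr M \ G).card = 3) (hk : kColoops M G = 2)
    {P : Finset α → Prop} [DecidablePred P] (hP : ∀ B, 4 ≤ (B \ coloops M G).card → P B) {E : ℚ} (hE : 0 ≤ E)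
    (S ℓ : Finset α) (hℓ : rkN M ℓ ≤ 2)
    (hTE : ∀ T ∈ coverBases M G S 4, ∑ w ∈ T, faceLoss M 5 G (coloops M G ∪ T) w ≤ E) :
    pi2MassH M 5 G P S ≤
      (lineCount ((S \ coloops M G) ∩ ℓ).card ((S \ coloops M G) \ ℓ).card : ℚ) *
        (E / ((2 ^ ((G.card - kColoops M G) - 4) - 1 : ℕ) : ℚ)) := by
  have hd' : (gr M \ G).card ≤ 5 := by omega
  have hk' : kColoops M G + 4 = 5 + 1 := by omega
  have hP' : ∀ B ∈ thinMembers M 5 G, ¬ P B → (B \ coloops M G).card + 1 = 4 := by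
    intro B hB hnP
    have h3 := card_sdiff_coloops_thin_ge hG hd' hk' hB
    by_contra h
    exact hnP (hP B (by omega))
  refine (pi2MassH_le_coverBases hG hd (by norm_num) hk' hP' S hTE).trans ?_
  apply mul_le_mul_of_nonneg_right _ (div_nonneg hE (by positivity))
  exact_mod_cast card_coverBases_le_lineCount S ℓ hℓ

end BasisMass

end PercRepro.Shadow
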